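import Mathlib
import Literature.MathematicalPhysics.QuantumFieldTheory.Balaban1983to89.B6RandomWalk

/-!
# `Balaban1983to89.B9Thm314ResolventTwoMetric` — [Balaban1985BackgroundPropagators] Theorem 3.14 (pp. 426–427, (3.154)) by the resolvent route when the two
# operators decay in TWO DIFFERENT multiscale distances (the two sequences {Ω_j}, {Ω′_j} have two distances (2.46)): the middle-factor engine produces the
# ADDITIONAL FACTOR `e^{−(δ/2)F}` ALONE (no characteristic decay), from the left operator's distance `d₁`, ANY decay profile `e₂` of the right operator, and a common
# minorant pseudo-distance `t` (the lattice distance |y − y′| of (3.154)); the characteristic factor is then re-attached from the plain two-term bound by the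
# geometric mean `min(P, Q) ≤ √(PQ)` (`hasMajorant_geomMean`) — the structure of the tree's U = 1 proof `B9Thm314GpFlatMultiLevelTorus` (`trivial_bound`,
# `combined_bound`, `resolvent_bound`), carrier-free

B9 = T. Bałaban, *Propagators for lattice gauge theories in a background field*, Commun. Math. Phys. **99** (1985) 389–434 [Balaban1985BackgroundPropagators], Thm 3.14 (3.154)
pp. 426–427; [4] = [Balaban1984PropagatorsII] (2.46) p. 231, (2.51)–(2.55) p. 232, (2.61) p. 234.

WHY (DAG node N06, seat `pub-ymgap-dag-n06-a`; design note `B9-PIN-DESIGN-g2.md` §8 «LOCATED CAVEAT (two metrics)»).  `B9Thm314ResolventCore∕…Weighted` assume ONE distance with (2.54);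
a Thm-3.14 member carries d_D and d_{D′}, and `min(d_D, d_{D′})` satisfies (2.61) but not (2.54).  Resolution (as in the flat precedent): (a) the RESOLVENT term needs the
triangle inequality only for the COMMON lattice distance `t` (symmetric in neither family; `t ≤ d₁` on the left operator's blocks, `t(y₂,b) ≤ e₂(y₂,b)` for the right
operator's profile) and yields `C₁vC₂c²·e^{−(δ/2)F}`; (b) the PLAIN bound `|((G′[D] − G′[D′])λ)(x)| ≤ |G′[D]λ| + |G′[D′]λ|` yields the characteristic factor (with whatever
distance each operator carries); (c) `min ≤ geometric mean` multiplies the two: characteristic factor at half rate × additional factor at quarter rate.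

WHAT IS PROVED (kernel; no `sorry`; every analytic input displayed):
* `hasMajorant_resolvent_twoMetric` — T₁: `K₁ ≤ C₁e^{−δd₁(a,y)}`; V: `0 ≤ K_V ≤ v·e^{−2δd₁(y₁,y₂)}`, rows zero off `S`; T₂: `0 ≤ K₂ ≤ C₂e^{−δe₂(y,b)}` for ANY profile `e₂` with
  `t(y,b) ≤ e₂(y,b)`; `t` a pseudo-distance (triangle, `≥ 0`) with `t ≤ d₁`; `d₁ ≥ 0`; `Σ_{y′}e^{−(δ/2)d₁(y,y′)} ≤ c`; `F(a,b) ≤ t(a,y₁) + t(y₁,b)` for `y₁ ∈ S` ((3.154))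
  ⇒ `T₁VT₂` has majorant `C₁vC₂c²·e^{−(δ/2)F(a,b)}`;
* `hasMajorant_geomMean` — two majorants `K, K′ ≥ 0` of the same operator give the majorant `√(KK′)`; `sqrt_exp_mul_exp` — the arithmetic
  `√(Ae^{−p}·Be^{−q}) = √(AB)·e^{−p/2}·e^{−q/2}`.
HONEST SCOPE: prefactor-free; one block structure for the composition (the right operator's majorant re-blocked beforehand, `B6MajorantReblock`, its profile `e₂`
kept abstract); sup entries; count-neutral; NOT continuum ∕ Clay.
-/

namespace Literature.MathematicalPhysics.QuantumFieldTheory.Balaban1983to89.B9Thm314ResolventTwoMetric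

open Finset
open Literature.MathematicalPhysics.QuantumFieldTheory.Balaban1983to89.B6RandomWalk (HasMajorant BlockSupp hasMajorant_mono hasMajorant_mul)

variable {g : B6.Geometry} {X : Type}

/-- [4] (2.55) twice (as in `B9Thm314ResolventCore.hasMajorant_mul₃`; restated privately to keep this file's imports minimal). [cite: Balaban1984PropagatorsII, (2.52)–(2.55) p.232] -/
private theorem hasMajorant_mul₃ (blk : X → g.Site) {T₁ V T₂ : Module.End ℝ (X → ℝ)} {K₁ KV K₂ : g.Site → g.Site → ℝ}
    (h₁ : HasMajorant blk T₁ K₁) (hV : HasMajorant blk V KV) (h₂ : HasMajorant blk T₂ K₂) (hKV : ∀ a b, 0 ≤ KV a b)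
    (hK₂ : ∀ a b, 0 ≤ K₂ a b) :
    HasMajorant blk (T₁ * V * T₂) (fun a b => ∑ y₁ : g.Site, ∑ y₂ : g.Site, K₁ a y₁ * KV y₁ y₂ * K₂ y₂ b) := by
  refine hasMajorant_mono blk (hasMajorant_mul blk (hasMajorant_mul blk h₁ hV hKV) h₂ hK₂) fun a b => le_of_eq ?_
  simp only [Finset.sum_mul]
  rw [Finset.sum_comm]

/-- (2.61) at a weaker rate dominates the sum at a stronger one (for `d ≥ 0`). [cite: Balaban1984PropagatorsII, Lemma 2.1 (2.61) p.234 (bookkeeping)] -/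
private theorem sum_exp_le_of_rate {σ δ c : ℝ} (hσδ : σ ≤ δ) (hd : ∀ a b : g.Site, 0 ≤ g.dist a b)
    (hsum : ∀ y : g.Site, ∑ y' : g.Site, Real.exp (-(σ * g.dist y y')) ≤ c) (y : g.Site) :
    ∑ y' : g.Site, Real.exp (-(δ * g.dist y y')) ≤ c := by
  refine le_trans (Finset.sum_le_sum fun y' _ => ?_) (hsum y)
  exact Real.exp_le_exp.2 (neg_le_neg (mul_le_mul_of_nonneg_right hσδ (hd y y')))

/-- **THE TWO-METRIC RESOLVENT ENGINE** (see the module docstring): the additional factor `e^{−(δ/2)F}` from the left operator's distance `d₁ = g.dist`, an arbitrary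
decay profile `e₂` of the right operator dominating the common lattice distance `t`, and `t`'s triangle inequality. [cite: Balaban1985BackgroundPropagators, Thm 3.14 (3.154) pp.426–427 (bookkeeping: the resolvent route, two sequences); Balaban1984PropagatorsII, (2.54)–(2.55) pp.232–233 and (2.61) p.234] -/
theorem hasMajorant_resolvent_twoMetric (blk : X → g.Site) (hd : ∀ a b : g.Site, 0 ≤ g.dist a b)
    (t : g.Site → g.Site → ℝ) (ht0 : ∀ a b, 0 ≤ t a b) (httri : ∀ a b c, t a c ≤ t a b + t b c) (htd : ∀ a b, t a b ≤ g.dist a b)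
    (e₂ : g.Site → g.Site → ℝ) (hte₂ : ∀ a b, t a b ≤ e₂ a b)
    {δ c C₁ C₂ v : ℝ} (hδ : 0 ≤ δ) (hc : 0 ≤ c) (hC₁ : 0 ≤ C₁) (hC₂ : 0 ≤ C₂) (hv : 0 ≤ v)
    (hsum : ∀ y : g.Site, ∑ y' : g.Site, Real.exp (-(δ / 2 * g.dist y y')) ≤ c)
    (S : Set g.Site) (F : g.Site → g.Site → ℝ) (hF : ∀ a b y₁ : g.Site, y₁ ∈ S → F a b ≤ t a y₁ + t y₁ b)
    {T₁ V T₂ : Module.End ℝ (X → ℝ)} {K₁ KV K₂ : g.Site → g.Site → ℝ}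
    (h₁ : HasMajorant blk T₁ K₁) (hV : HasMajorant blk V KV) (h₂ : HasMajorant blk T₂ K₂)
    (hKV0 : ∀ a b, 0 ≤ KV a b) (hK₂0 : ∀ a b, 0 ≤ K₂ a b)
    (hK₁ : ∀ a y : g.Site, K₁ a y ≤ C₁ * Real.exp (-(δ * g.dist a y)))
    (hKV : ∀ y₁ y₂ : g.Site, KV y₁ y₂ ≤ v * Real.exp (-(2 * δ * g.dist y₁ y₂)))
    (hKVS : ∀ y₁ y₂ : g.Site, y₁ ∉ S → KV y₁ y₂ = 0)
    (hK₂ : ∀ y b : g.Site, K₂ y b ≤ C₂ * Real.exp (-(δ * e₂ y b))) :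
    HasMajorant blk (T₁ * V * T₂) (fun a b => C₁ * v * C₂ * c * c * Real.exp (-(δ / 2 * F a b))) := by
  refine hasMajorant_mono blk (hasMajorant_mul₃ blk h₁ hV h₂ hKV0 hK₂0) fun a b => ?_
  have hCvc : 0 ≤ C₁ * v * C₂ * c := mul_nonneg (mul_nonneg (mul_nonneg hC₁ hv) hC₂) hc
  -- inner sum: Σ_{y₂} e^{−2δd₁(y₁,y₂)} e^{−δe₂(y₂,b)} ≤ c·e^{−δt(y₁,b)}
  have inner : ∀ y₁ : g.Site, ∑ y₂ : g.Site, Real.exp (-(2 * δ * g.dist y₁ y₂)) * Real.exp (-(δ * e₂ y₂ b)) ≤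
      c * Real.exp (-(δ * t y₁ b)) := by
    intro y₁
    have hterm : ∀ y₂ : g.Site, Real.exp (-(2 * δ * g.dist y₁ y₂)) * Real.exp (-(δ * e₂ y₂ b)) ≤
        Real.exp (-(δ * g.dist y₁ y₂)) * Real.exp (-(δ * t y₁ b)) := by
      intro y₂
      rw [← Real.exp_add, ← Real.exp_add]
      apply Real.exp_le_exp.2
      have h1 := httri y₁ y₂ b
      have h2 := htd y₁ y₂
      have h3 := hte₂ y₂ b
      have h4 : δ * t y₁ b ≤ δ * (g.dist y₁ y₂ + e₂ y₂ b) := mul_le_mul_of_nonneg_left (by linarith) hδ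
      linarith
    calc ∑ y₂ : g.Site, Real.exp (-(2 * δ * g.dist y₁ y₂)) * Real.exp (-(δ * e₂ y₂ b))
        ≤ ∑ y₂ : g.Site, Real.exp (-(δ * g.dist y₁ y₂)) * Real.exp (-(δ * t y₁ b)) := Finset.sum_le_sum fun y₂ _ => hterm y₂
      _ = (∑ y₂ : g.Site, Real.exp (-(δ * g.dist y₁ y₂))) * Real.exp (-(δ * t y₁ b)) := by rw [Finset.sum_mul]
      _ ≤ c * Real.exp (-(δ * t y₁ b)) :=
          mul_le_mul_of_nonneg_right (sum_exp_le_of_rate (by linarith) hd hsum y₁) (Real.exp_nonneg _)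
  have step : ∀ y₁ : g.Site, ∑ y₂ : g.Site, K₁ a y₁ * KV y₁ y₂ * K₂ y₂ b ≤
      C₁ * v * C₂ * c * Real.exp (-(δ / 2 * F a b)) * Real.exp (-(δ / 2 * g.dist a y₁)) := by
    intro y₁
    by_cases hy : y₁ ∈ S
    · have t1 : ∀ y₂ : g.Site, K₁ a y₁ * KV y₁ y₂ * K₂ y₂ b ≤
          C₁ * Real.exp (-(δ * g.dist a y₁)) * (v * Real.exp (-(2 * δ * g.dist y₁ y₂))) * (C₂ * Real.exp (-(δ * e₂ y₂ b))) :=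
        fun y₂ => mul_le_mul (mul_le_mul (hK₁ a y₁) (hKV y₁ y₂) (hKV0 _ _) (mul_nonneg hC₁ (Real.exp_nonneg _))) (hK₂ y₂ b)
          (hK₂0 _ _) (mul_nonneg (mul_nonneg hC₁ (Real.exp_nonneg _)) (mul_nonneg hv (Real.exp_nonneg _)))
      have hsum₁ : ∑ y₂ : g.Site, K₁ a y₁ * KV y₁ y₂ * K₂ y₂ b ≤
          C₁ * Real.exp (-(δ * g.dist a y₁)) * v * C₂ *
            ∑ y₂ : g.Site, Real.exp (-(2 * δ * g.dist y₁ y₂)) * Real.exp (-(δ * e₂ y₂ b)) := by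
        rw [Finset.mul_sum]
        refine Finset.sum_le_sum fun y₂ _ => (t1 y₂).trans (le_of_eq ?_)
        ring
      have hpre : 0 ≤ C₁ * Real.exp (-(δ * g.dist a y₁)) * v * C₂ :=
        mul_nonneg (mul_nonneg (mul_nonneg hC₁ (Real.exp_nonneg _)) hv) hC₂
      have hexp : Real.exp (-(δ * g.dist a y₁)) * Real.exp (-(δ * t y₁ b)) ≤
          Real.exp (-(δ / 2 * F a b)) * Real.exp (-(δ / 2 * g.dist a y₁)) := by
        rw [← Real.exp_add, ← Real.exp_add]
        apply Real.exp_le_exp.2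
        have hFab := hF a b y₁ hy
        have h1 := htd a y₁
        have h2 := ht0 y₁ b
        have h3 := hd a y₁
        have h4 : δ / 2 * F a b ≤ δ / 2 * (g.dist a y₁ + t y₁ b) := mul_le_mul_of_nonneg_left (by linarith) (by linarith)
        nlinarith
      calc ∑ y₂ : g.Site, K₁ a y₁ * KV y₁ y₂ * K₂ y₂ b
          ≤ C₁ * Real.exp (-(δ * g.dist a y₁)) * v * C₂ * (c * Real.exp (-(δ * t y₁ b))) :=
            hsum₁.trans (mul_le_mul_of_nonneg_left (inner y₁) hpre)
        _ = C₁ * v * C₂ * c * (Real.exp (-(δ * g.dist a y₁)) * Real.exp (-(δ * t y₁ b))) := by ring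
        _ ≤ C₁ * v * C₂ * c * (Real.exp (-(δ / 2 * F a b)) * Real.exp (-(δ / 2 * g.dist a y₁))) :=
            mul_le_mul_of_nonneg_left hexp hCvc
        _ = C₁ * v * C₂ * c * Real.exp (-(δ / 2 * F a b)) * Real.exp (-(δ / 2 * g.dist a y₁)) := by ring
    · have h0 : ∀ y₂ : g.Site, K₁ a y₁ * KV y₁ y₂ * K₂ y₂ b = 0 := fun y₂ => by rw [hKVS y₁ y₂ hy, mul_zero, zero_mul]
      simp only [h0, Finset.sum_const_zero]
      exact mul_nonneg (mul_nonneg hCvc (Real.exp_nonneg _)) (Real.exp_nonneg _)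
  calc ∑ y₁ : g.Site, ∑ y₂ : g.Site, K₁ a y₁ * KV y₁ y₂ * K₂ y₂ b
      ≤ ∑ y₁ : g.Site, C₁ * v * C₂ * c * Real.exp (-(δ / 2 * F a b)) * Real.exp (-(δ / 2 * g.dist a y₁)) :=
        Finset.sum_le_sum fun y₁ _ => step y₁
    _ = C₁ * v * C₂ * c * Real.exp (-(δ / 2 * F a b)) * ∑ y₁ : g.Site, Real.exp (-(δ / 2 * g.dist a y₁)) := by
        rw [Finset.mul_sum]
    _ ≤ C₁ * v * C₂ * c * Real.exp (-(δ / 2 * F a b)) * c :=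
        mul_le_mul_of_nonneg_left (hsum a) (mul_nonneg hCvc (Real.exp_nonneg _))
    _ = C₁ * v * C₂ * c * c * Real.exp (-(δ / 2 * F a b)) := by ring

/-- **Two majorants combine by the geometric mean** (`min(P, Q) ≤ √(PQ)`): if `T` has the majorants `K ≥ 0` and `K′ ≥ 0`, it has the majorant `√(K·K′)` — the step that
multiplies the characteristic factor (from the plain two-term bound) with the additional factor (from the resolvent engine), as in the flat precedent's `combined_bound`.
[cite: Balaban1985BackgroundPropagators, Thm 3.14 (3.154) pp.426–427 (bookkeeping: characteristic × additional factor)] -/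
theorem hasMajorant_geomMean (blk : X → g.Site) {T : Module.End ℝ (X → ℝ)} {K K' : g.Site → g.Site → ℝ} (h : HasMajorant blk T K)
    (h' : HasMajorant blk T K') (hK : ∀ a b, 0 ≤ K a b) (hK' : ∀ a b, 0 ≤ K' a b) :
    HasMajorant blk T (fun a b => Real.sqrt (K a b * K' a b)) := by
  intro b μ B hμ x
  have h1 := h b μ B hμ x
  have h2 := h' b μ B hμ x
  have hB := hμ.nonneg
  have habs : 0 ≤ |T μ x| := abs_nonneg _
  have hsq : |T μ x| * |T μ x| ≤ (K (blk x) b * K' (blk x) b) * (B * B) := by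
    calc |T μ x| * |T μ x| ≤ (K (blk x) b * B) * (K' (blk x) b * B) := mul_le_mul h1 h2 habs (mul_nonneg (hK _ _) hB)
      _ = (K (blk x) b * K' (blk x) b) * (B * B) := by ring
  have hKK : 0 ≤ K (blk x) b * K' (blk x) b := mul_nonneg (hK _ _) (hK' _ _)
  calc |T μ x| = Real.sqrt (|T μ x| * |T μ x|) := (Real.sqrt_mul_self habs).symm
    _ ≤ Real.sqrt ((K (blk x) b * K' (blk x) b) * (B * B)) := Real.sqrt_le_sqrt hsq
    _ = Real.sqrt (K (blk x) b * K' (blk x) b) * B := by rw [Real.sqrt_mul hKK, Real.sqrt_mul_self hB]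

/-- The arithmetic of the combination: `√(A·e^{−p} · (B·e^{−q})) = √(A·B)·e^{−p/2}·e^{−q/2}` for `A, B ≥ 0`. [cite: Balaban1985BackgroundPropagators, Thm 3.14 p.427 («after adjusting a definition of δ₀», bookkeeping)] -/
theorem sqrt_exp_mul_exp {A B p q : ℝ} (hA : 0 ≤ A) (hB : 0 ≤ B) :
    Real.sqrt (A * Real.exp (-p) * (B * Real.exp (-q))) = Real.sqrt (A * B) * Real.exp (-(p / 2)) * Real.exp (-(q / 2)) := by
  have hre : A * Real.exp (-p) * (B * Real.exp (-q)) = (A * B) * (Real.exp (-(p / 2)) * Real.exp (-(q / 2))) ^ 2 := by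
    rw [sq, show Real.exp (-(p / 2)) * Real.exp (-(q / 2)) * (Real.exp (-(p / 2)) * Real.exp (-(q / 2))) =
      (Real.exp (-(p / 2)) * Real.exp (-(p / 2))) * (Real.exp (-(q / 2)) * Real.exp (-(q / 2))) by ring,
      ← Real.exp_add, ← Real.exp_add]
    ring_nf
  rw [hre, Real.sqrt_mul (mul_nonneg hA hB), Real.sqrt_sq (mul_nonneg (Real.exp_nonneg _) (Real.exp_nonneg _))]
  ring

end Literature.MathematicalPhysics.QuantumFieldTheory.Balaban1983to89.B9Thm314ResolventTwoMetric
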